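import Literature.AlgebraicGeometry.HodgeTheory.RealMultiplicationHodgeLieAlgebra
import Literature.AlgebraicGeometry.HodgeTheory.BettiOneHodgeStructureModelIndependence
import Literature.AlgebraicGeometry.HodgeTheory.WeilTypeRationalDatum
import Literature.AlgebraicGeometry.Motives.HodgeLieRealPlacesRank
import HarnessLib

/-!
# `dim Lie Hg(H¹B) = 3 dim B` and `dim MT(H¹B) = 3 dim B + 1` for real multiplication of relative dimension one (Ribet 1983: `Hg(B) = R_{E/ℚ} SL₂`)

For a complex abelian variety `B` whose endomorphism algebra `End⁰(B)` is a TOTALLY REAL FIELD `E` of degree `dim B`, the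
Hodge group is `R_{E/ℚ} SL_{2,E}` (Ribet 1983 Thm. 1; Hazama 1983 §3: «`𝔥 = 𝔰𝔩₂ × ⋯ × 𝔰𝔩₂` (`k` times)»).  The tree has
the Lie-algebra form of this (`RealMultiplicationHodgeLieAlgebra`: `Lie Hg(B) ⊗ ℂ = ⊕_τ 𝔰𝔩(V_τ)` over the embeddings
`τ : E → ℂ`, each `V_τ` two-dimensional); this file draws the DIMENSION COUNT:

* **`finrank_hodgeLie_hodge_one_of_isTotallyReal`** — `dim_ℚ Lie Hg(H¹B) = 3 dim B`;
* **`mtRank_hodge_one_of_isTotallyReal`** — `dim MT(H¹B) = 3 dim B + 1` (the tree's `dim MT = dim Lie Hg + 1`), also in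
  the form with an arbitrary smooth-projective witness `hX : IsSmoothProjective n B.X` used by the rank ladder
  (`mtRank_hodge_one_of_isTotallyReal'`).

So real-multiplication abelian varieties of relative dimension one sit on the rung `t = 3 dim B + 1` of the Mumford–Tate rank
ladder (surfaces: `t = 7`).  UNCONDITIONAL; no definition, no named fact.  Research context: cell `pub-hodgecm2` (COR-CM, seat
b27 gen 40), the converse direction of the rung `t = 7` (`CorCM/MumfordTateRankSevenSimpleConverse`).

## References
* [Ribet1983] K. A. Ribet, *Hodge classes on certain types of abelian varieties*, Amer. J. Math. 105 (1983), Thm. 0–1.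
  [cite: Ribet1983, Thm. 0–1]
* [Hazama1983] F. Hazama, Tôhoku Math. J. 35 (1983), Thm. (1.1) and §3 (pp. 305–306). [cite: Hazama1983, Thm. (1.1) and §3 (pp. 305–306)]
* [MoonenZarhin1999LowDim] B. Moonen, Yu. Zarhin, Math. Ann. 315 (1999), §2 (2.2) (type I(2): `Hg = R_{K/ℚ}SL₂`).
  [cite: MoonenZarhin1999LowDim, §2 (2.2)]
-/

noncomputable section

open scoped TensorProduct
open CategoryTheory Module NumberField

namespace Literature.AlgebraicGeometry.HodgeTheory

open Literature.AlgebraicGeometry.Motives Literature.AlgebraicGeometry.ComplexMultiplication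
open Literature.AlgebraicGeometry.Motives.HodgeStructure

section RealMultiplication

variable {B : AbelianVariety ℂ} (hF : IsField B.endAlgebra)

/-- A number field has positive degree. [folklore] -/
private theorem finrank_pos_of_numberField' (E : Type*) [Field E] [NumberField E] :
    0 < Module.finrank ℚ E := Module.finrank_pos

include hF in
/-- `dim B > 0` when `[End⁰(B) : ℚ] = dim B` (a number field has positive degree). [folklore] -/
private theorem dim_pos_of_finrank_eq'' (hdeg : Module.finrank ℚ B.endAlgebra = B.dim) : 0 < B.dim := by
  have h := finrank_pos_of_numberField' (EndField B hF)
  rw [EndField.finrank_eq hF, hdeg] at h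
  exact h

/-- **`dim_ℚ Lie Hg(H¹B) = 3 dim B` for `End⁰(B)` a totally real field of degree `dim B`** (Ribet: `Hg(B) = R_{E/ℚ} SL_{2,E}`,
of dimension `3[E:ℚ]`; the tree's block form `Lie Hg(B) ⊗ ℂ = ⊕_τ 𝔰𝔩(V_τ)` over the `[E:ℚ] = dim B` embeddings `τ : E → ℂ`,
counted by `HodgeStructure.finrank_hodgeLie_eq_of_real_blocks`). [cite: Ribet1983, Thm. 0–1]
[cite: Hazama1983, Thm. (1.1) and §3 (pp. 305–306)] -/
theorem finrank_hodgeLie_hodge_one_of_isTotallyReal [HodgeTensorFacts.{0, 0}]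
    [Module.Finite ℚ (bettiCohomology B.X 1)]
    (hHD : exists_isReal_hodgeModel) (hI : hodgePQ_independent_of_hodgeModel)
    [IsTotallyReal (EndField B hF)] (hdeg : Module.finrank ℚ B.endAlgebra = B.dim) :
    Module.finrank ℚ (BettiUniverse.hodge hHD (AbelianVariety.isSmoothProjective_holds (A := B)) 1).hodgeLie =
      3 * B.dim := by
  classical
  have h0 : 0 < B.dim := dim_pos_of_finrank_eq'' hF hdeg
  obtain ⟨ψ⟩ := BettiUniverse.hodge_isPolarizable hHD (AbelianVariety.isSmoothProjective_holds (A := B)) 1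
  have hodd : Odd (((1 : ℕ) : ℤ)) := ⟨0, by norm_num⟩
  have h := finrank_hodgeLie_eq_of_real_blocks
    (BettiUniverse.hodge hHD (AbelianVariety.isSmoothProjective_holds (A := B)) 1) hodd ψ
    (isAdjointPair_self_of_isTotallyReal hF hHD hI h0 ψ) (hodgeCharacter hF hHD hI) (hodgeCharacter_isReal hF hHD hI)
    (isInternal_eigenBlock_hodgeCharacter hF hHD hI) (finrank_eigenBlock_hodgeCharacter hF hHD hI hdeg)
  rw [h, Embeddings.card, EndField.finrank_eq hF, hdeg]

/-- **`dim MT(H¹B) = 3 dim B + 1` for `End⁰(B)` a totally real field of degree `dim B`** (`MT = 𝔾_m · R_{E/ℚ} SL_{2,E}`).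
[cite: Ribet1983, Thm. 0–1] [cite: Hazama1983, Thm. (1.1) and §3 (pp. 305–306)] [cite: MoonenZarhin1999LowDim, §2 (2.2)] -/
theorem mtRank_hodge_one_of_isTotallyReal [HodgeTensorFacts.{0, 0}]
    [Module.Finite ℚ (bettiCohomology B.X 1)]
    (hHD : exists_isReal_hodgeModel) (hI : hodgePQ_independent_of_hodgeModel)
    [IsTotallyReal (EndField B hF)] (hdeg : Module.finrank ℚ B.endAlgebra = B.dim) :
    (BettiUniverse.hodge hHD (AbelianVariety.isSmoothProjective_holds (A := B)) 1).mtRank = 3 * B.dim + 1 := by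
  classical
  have h0 : 0 < B.dim := dim_pos_of_finrank_eq'' hF hdeg
  haveI : Nontrivial (bettiCohomology B.X 1) := by
    apply Module.nontrivial_of_finrank_pos (R := ℚ)
    rw [finrank_bettiCohomology_one]
    omega
  obtain ⟨ψ⟩ := BettiUniverse.hodge_isPolarizable hHD (AbelianVariety.isSmoothProjective_holds (A := B)) 1
  rw [mtRank_eq_finrank_hodgeLie_add_one _ ψ (by norm_num), finrank_hodgeLie_hodge_one_of_isTotallyReal hF hHD hI hdeg]

/-- The same with an arbitrary smooth-projective witness `hX : IsSmoothProjective n B.X` and the tree's model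
`exists_isReal_hodgeModel_holds` (the form used on the Mumford–Tate rank ladder, `CorCM/MumfordTateRank*`).
[cite: Ribet1983, Thm. 0–1] [cite: MoonenZarhin1999LowDim, §2 (2.2)] -/
theorem mtRank_hodge_one_of_isTotallyReal' [HodgeTensorFacts.{0, 0}] {n : ℕ} (hX : IsSmoothProjective n B.X)
    [IsTotallyReal (EndField B hF)] (hdeg : Module.finrank ℚ B.endAlgebra = B.dim) :
    haveI := BettiUniverse.finite hX 1
    (BettiUniverse.hodge exists_isReal_hodgeModel_holds hX 1).mtRank = 3 * B.dim + 1 ∧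
      Module.finrank ℚ (BettiUniverse.hodge exists_isReal_hodgeModel_holds hX 1).hodgeLie = 3 * B.dim := by
  have hn : B.dim = n := schemeDim_eq_holds hX
  subst hn
  haveI := BettiUniverse.finite hX 1
  exact ⟨mtRank_hodge_one_of_isTotallyReal hF exists_isReal_hodgeModel_holds hodgePQ_independent_of_hodgeModel_holds hdeg,
    finrank_hodgeLie_hodge_one_of_isTotallyReal hF exists_isReal_hodgeModel_holds
      hodgePQ_independent_of_hodgeModel_holds hdeg⟩

end RealMultiplication

end Literature.AlgebraicGeometry.HodgeTheory

end
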